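import Summits.AtomisticToContinuum.Crystallization.Theorems.FrustratedLawDichotomyCellArithTaylor
import Summits.AtomisticToContinuum.Crystallization.Theorems.FrustratedLawDichotomyCellMetric

/-!
# FrustratedLawDichotomy · crux `AperiodicFrustratedLawGap` (stmt-AtomisticToContinuum-27623) — CELL-ARITH, the «genuinely 2-D»
# readings (critic r1772 (B), last clause): a COORDINATE BOX of a label vector ⟶ an `S²`-scaled reading of its Gram square ⟶ a norm
# witness (the NASH number `nn` of a label WITH interior neighbours), the host-force PAIRING terms `ψ(t)·g` of the `hf` column, and
# the coordinates of (252) `linLab` (decomp-a2c hand-1 g53; multipliers in the label frame per lens-5 AMEND l.9363)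

Layout-free (no lists): the K-file evaluates (252) `nashVecLab` coordinate by coordinate as a signed sum of the terms read here and
feeds the two packaged conclusions.

* §1 `pairLo/pairHi` — four-corner readings at scale `S²` of a product of two scale-`S` readings; ★ `gramHiZ2 Glo Ghi WL WH`
  (`gramLoZ2`) — `S²·gram G W W ≤ gramHiZ2` from `WL i ≤ S·W i ≤ WH i` and an exact entrywise box `Glo ≤ G ≤ Ghi`
  ((252) `gram`; nine `cornerHi`'s of `…CellArithTaylor`); ★ `norm_posL_le_of_gramHiZ2` — `gramHiZ2 ≤ S²·b² ⇒ ‖posL F W‖ ≤ b`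
  (the (251) `hnn` number `b` by ONE decidable integer comparison, via (252) `norm_posL_le` + `nashVec_posL`);
* §2 ★ `pairing_le_cornerHi` / `cornerLo_le_pairing` — `S·(ψ(t)·g) ≤ cornerHi (psiLoZ S lo hi) (psiHiZ S lo hi) glo ghi` on
  `lo ≤ t ≤ hi`, `glo ≤ g ≤ ghi` (one term of (252) `inner_posL_sum_ljBondForce`), and `le_finsetSum_readings` (a `Finset` sum of
  upper readings), so the `hf` column entry is a sum of `cornerHi`'s plus `‖Y‖·psiTail` (read by `…CellArithTails.le_psiTailHiZ`);
* §3 ★ `linLabLoZ/linLabHiZ` — readings of the coordinates of (252) `linLab G z y` from the `ψ`/`ψ′` window readings of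
  `…CellArithLJ`, the exact interval of `g(z, y)` and the exact rational coordinates `y i`, `z i` (`linLabLoZ_le`, `le_linLabHiZ`);
  `smulCoordLo/Hi` for the leading term `ψ(g(a,a))·a i` of `nashVecLab`.

Plain computable `def`s (`ℤ`/`ℚ`), no instance / notation / option; imports `…CellArithTaylor` + (252) `…CellMetric`; 0 sorry.  Tags: [folklore].
-/

namespace Summit.AtomisticToContinuum.Crystallization.Theorems.FrustratedLawDichotomyCellArithGram

open scoped BigOperators
open Summit.AtomisticToContinuum.Crystallization.Theorems.FrustratedLawDichotomyCoherentFloorAlgebra (psiT psiT1)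
open Summit.AtomisticToContinuum.Crystallization.Theorems.FrustratedLawDichotomyCellEnclosures (mul_le_of_corners corners_le_mul)
open Summit.AtomisticToContinuum.Crystallization.Theorems.FrustratedLawDichotomyCellMetric (posL gram norm_posL_le linLab)
open Summit.AtomisticToContinuum.Crystallization.Theorems.FrustratedLawDichotomyCellArith
open Summit.AtomisticToContinuum.Crystallization.Theorems.FrustratedLawDichotomyCellArithLJ
open Summit.AtomisticToContinuum.Crystallization.Theorems.FrustratedLawDichotomyCellArithTaylor (cornerLo cornerHi le_cornerHi cornerLo_le)

/-! ## §1 Products of readings, the Gram square of a coordinate box, the norm witness -/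

/-- lower four-corner bound, at scale `S²`, of a product of two scale-`S` readings. [folklore] -/
def pairLo (aL aH bL bH : ℤ) : ℤ := min (min (aL * bL) (aL * bH)) (min (aH * bL) (aH * bH))

/-- upper four-corner bound, at scale `S²`, of a product of two scale-`S` readings. [folklore] -/
def pairHi (aL aH bL bH : ℤ) : ℤ := max (max (aL * bL) (aL * bH)) (max (aH * bL) (aH * bH))

/-- `pairLo ≤ S²·(x·y)`. [folklore] -/
theorem pairLo_le {S aL aH bL bH : ℤ} {x y : ℝ} (ha1 : (aL : ℝ) ≤ S * x) (ha2 : S * x ≤ (aH : ℝ)) (hb1 : (bL : ℝ) ≤ S * y)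
    (hb2 : S * y ≤ (bH : ℝ)) : ((pairLo aL aH bL bH : ℤ) : ℝ) ≤ ((S ^ 2 : ℤ) : ℝ) * (x * y) := by
  have W := corners_le_mul ha1 ha2 hb1 hb2
  have e : ((S ^ 2 : ℤ) : ℝ) * (x * y) = (S * x) * (S * y) := by push_cast; ring
  rw [e]; unfold pairLo; push_cast; exact W

/-- `S²·(x·y) ≤ pairHi`. [folklore] -/
theorem le_pairHi {S aL aH bL bH : ℤ} {x y : ℝ} (ha1 : (aL : ℝ) ≤ S * x) (ha2 : S * x ≤ (aH : ℝ)) (hb1 : (bL : ℝ) ≤ S * y)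
    (hb2 : S * y ≤ (bH : ℝ)) : ((S ^ 2 : ℤ) : ℝ) * (x * y) ≤ ((pairHi aL aH bL bH : ℤ) : ℝ) := by
  have W := mul_le_of_corners ha1 ha2 hb1 hb2
  have e : ((S ^ 2 : ℤ) : ℝ) * (x * y) = (S * x) * (S * y) := by push_cast; ring
  rw [e]; unfold pairHi; push_cast; exact W

/-- ★ UPPER reading at scale `S²` of `gram G W W` from a coordinate box of readings and an exact entry box of `G`. [folklore] -/
def gramHiZ2 (Glo Ghi : Fin 3 → Fin 3 → ℚ) (WL WH : Fin 3 → ℤ) : ℤ :=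
  ∑ i, ∑ j, cornerHi (pairLo (WL i) (WH i) (WL j) (WH j)) (pairHi (WL i) (WH i) (WL j) (WH j)) (Glo i j) (Ghi i j)

/-- LOWER reading at scale `S²` of `gram G W W` (same data). [folklore] -/
def gramLoZ2 (Glo Ghi : Fin 3 → Fin 3 → ℚ) (WL WH : Fin 3 → ℤ) : ℤ :=
  ∑ i, ∑ j, cornerLo (pairLo (WL i) (WH i) (WL j) (WH j)) (pairHi (WL i) (WH i) (WL j) (WH j)) (Glo i j) (Ghi i j)

section Gram

variable {S : ℤ} {G : Matrix (Fin 3) (Fin 3) ℝ} {Glo Ghi : Fin 3 → Fin 3 → ℚ} {W : Fin 3 → ℝ} {WL WH : Fin 3 → ℤ}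

/-- ★ `S²·gram G W W ≤ gramHiZ2 Glo Ghi WL WH`. [folklore] -/
theorem le_gramHiZ2 (hlo : ∀ i j, ((Glo i j : ℚ) : ℝ) ≤ G i j) (hhi : ∀ i j, G i j ≤ ((Ghi i j : ℚ) : ℝ))
    (h1 : ∀ i, ((WL i : ℤ) : ℝ) ≤ S * W i) (h2 : ∀ i, S * W i ≤ ((WH i : ℤ) : ℝ)) :
    ((S ^ 2 : ℤ) : ℝ) * gram G W W ≤ ((gramHiZ2 Glo Ghi WL WH : ℤ) : ℝ) := by
  unfold gram gramHiZ2
  rw [Finset.mul_sum]; push_cast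
  refine Finset.sum_le_sum fun i _ => ?_
  rw [Finset.mul_sum]
  refine Finset.sum_le_sum fun j _ => ?_
  have e : ((S ^ 2 : ℤ) : ℝ) * (G i j * (W i * W j)) = ((S ^ 2 : ℤ) : ℝ) * ((W i * W j) * G i j) := by ring
  have h := le_cornerHi (S := S ^ 2) (pairLo_le (h1 i) (h2 i) (h1 j) (h2 j)) (le_pairHi (h1 i) (h2 i) (h1 j) (h2 j))
    (hlo i j) (hhi i j)
  push_cast at e h ⊢
  rw [e]; exact h

/-- ★ `gramLoZ2 Glo Ghi WL WH ≤ S²·gram G W W`. [folklore] -/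
theorem gramLoZ2_le (hlo : ∀ i j, ((Glo i j : ℚ) : ℝ) ≤ G i j) (hhi : ∀ i j, G i j ≤ ((Ghi i j : ℚ) : ℝ))
    (h1 : ∀ i, ((WL i : ℤ) : ℝ) ≤ S * W i) (h2 : ∀ i, S * W i ≤ ((WH i : ℤ) : ℝ)) :
    ((gramLoZ2 Glo Ghi WL WH : ℤ) : ℝ) ≤ ((S ^ 2 : ℤ) : ℝ) * gram G W W := by
  unfold gram gramLoZ2
  rw [Finset.mul_sum]; push_cast
  refine Finset.sum_le_sum fun i _ => ?_
  rw [Finset.mul_sum]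
  refine Finset.sum_le_sum fun j _ => ?_
  have e : ((S ^ 2 : ℤ) : ℝ) * (G i j * (W i * W j)) = ((S ^ 2 : ℤ) : ℝ) * ((W i * W j) * G i j) := by ring
  have h := cornerLo_le (S := S ^ 2) (pairLo_le (h1 i) (h2 i) (h1 j) (h2 j)) (le_pairHi (h1 i) (h2 i) (h1 j) (h2 j))
    (hlo i j) (hhi i j)
  push_cast at e h ⊢
  rw [e]; exact h

end Gram

/-- ★ THE NORM WITNESS: for the cell matrix `F` with `Glo ≤ FᵀF ≤ Ghi`, a coordinate box of readings of `W`, and a rational `b ≥ 0`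
with `gramHiZ2 ≤ S²·b²` (ONE decidable comparison), `‖posL F W‖ ≤ b` — with `W = nashVecLab …` and (252) `nashVec_posL` this is the
(251) `hnn` entry of a label with interior neighbours. [folklore] -/
theorem norm_posL_le_of_gramHiZ2 {S : ℤ} (F : Matrix (Fin 3) (Fin 3) ℝ) {Glo Ghi : Fin 3 → Fin 3 → ℚ} {W : Fin 3 → ℝ}
    {WL WH : Fin 3 → ℤ} {b : ℚ} (hS : 0 < S) (hlo : ∀ i j, ((Glo i j : ℚ) : ℝ) ≤ (F.transpose * F) i j)
    (hhi : ∀ i j, (F.transpose * F) i j ≤ ((Ghi i j : ℚ) : ℝ)) (h1 : ∀ i, ((WL i : ℤ) : ℝ) ≤ S * W i)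
    (h2 : ∀ i, S * W i ≤ ((WH i : ℤ) : ℝ)) (hb : 0 ≤ b) (hcert : ((gramHiZ2 Glo Ghi WL WH : ℤ) : ℚ) ≤ (S : ℚ) ^ 2 * b ^ 2) :
    ‖posL F W‖ ≤ (b : ℝ) := by
  have hS' : (0 : ℝ) < (S : ℝ) ^ 2 := by positivity
  have h := le_gramHiZ2 hlo hhi h1 h2
  have hc : ((gramHiZ2 Glo Ghi WL WH : ℤ) : ℝ) ≤ (S : ℝ) ^ 2 * (b : ℝ) ^ 2 := by exact_mod_cast hcert
  push_cast at h
  refine norm_posL_le F (by exact_mod_cast hb) ?_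
  nlinarith

/-! ## §2 The host-force pairing terms -/

/-- ★ one pairing term: `lo ≤ t ≤ hi`, `glo ≤ g ≤ ghi ⇒ S·(ψ(t)·g) ≤ cornerHi (psiLoZ S lo hi) (psiHiZ S lo hi) glo ghi`. [folklore] -/
theorem pairing_le_cornerHi {S : ℤ} {lo hi glo ghi : ℚ} {t g : ℝ} (hS : 0 < S) (h0 : 0 < lo) (h1 : (lo : ℝ) ≤ t)
    (h2 : t ≤ (hi : ℝ)) (hg1 : (glo : ℝ) ≤ g) (hg2 : g ≤ (ghi : ℝ)) :
    S * (psiT t * g) ≤ ((cornerHi (psiLoZ S lo hi) (psiHiZ S lo hi) glo ghi : ℤ) : ℝ) :=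
  le_cornerHi (psiLoZ_le hS h0 h1 h2) (le_psiHiZ hS h0 h1 h2) hg1 hg2

/-- ★ one pairing term from below: `cornerLo (psiLoZ …) (psiHiZ …) glo ghi ≤ S·(ψ(t)·g)`. [folklore] -/
theorem cornerLo_le_pairing {S : ℤ} {lo hi glo ghi : ℚ} {t g : ℝ} (hS : 0 < S) (h0 : 0 < lo) (h1 : (lo : ℝ) ≤ t)
    (h2 : t ≤ (hi : ℝ)) (hg1 : (glo : ℝ) ≤ g) (hg2 : g ≤ (ghi : ℝ)) :
    ((cornerLo (psiLoZ S lo hi) (psiHiZ S lo hi) glo ghi : ℤ) : ℝ) ≤ S * (psiT t * g) :=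
  cornerLo_le (psiLoZ_le hS h0 h1 h2) (le_psiHiZ hS h0 h1 h2) hg1 hg2

/-- a `Finset` sum of upper readings is an upper reading of the sum (the `hf` column is such a sum). [folklore] -/
theorem le_finsetSum_readings {α : Type*} (S : ℤ) (s : Finset α) (f : α → ℝ) (T : α → ℤ)
    (h : ∀ a ∈ s, S * f a ≤ ((T a : ℤ) : ℝ)) : S * ∑ a ∈ s, f a ≤ ((∑ a ∈ s, T a : ℤ) : ℝ) := by
  rw [Finset.mul_sum]; push_cast; exact Finset.sum_le_sum h

/-- a `Finset` sum of lower readings is a lower reading of the sum. [folklore] -/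
theorem finsetSum_readings_le {α : Type*} (S : ℤ) (s : Finset α) (f : α → ℝ) (T : α → ℤ)
    (h : ∀ a ∈ s, ((T a : ℤ) : ℝ) ≤ S * f a) : ((∑ a ∈ s, T a : ℤ) : ℝ) ≤ S * ∑ a ∈ s, f a := by
  rw [Finset.mul_sum]; push_cast; exact Finset.sum_le_sum h

/-! ## §3 Coordinates of `linLab` and of the leading term of `nashVecLab` -/

/-- lower reading of `c·x` for an exact rational `c` of EITHER sign from a reading interval of `x` (two corners). [folklore] -/
def smulCoordLo (XL XH : ℤ) (c : ℚ) : ℤ := min ⌊c * (XL : ℚ)⌋ ⌊c * (XH : ℚ)⌋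

/-- upper reading of `c·x` for an exact rational `c` of either sign. [folklore] -/
def smulCoordHi (XL XH : ℤ) (c : ℚ) : ℤ := max ⌈c * (XL : ℚ)⌉ ⌈c * (XH : ℚ)⌉

/-- `smulCoordLo ≤ S·(x·c)`. [folklore] -/
theorem smulCoordLo_le {S XL XH : ℤ} {c : ℚ} {x : ℝ} (h1 : (XL : ℝ) ≤ S * x) (h2 : S * x ≤ (XH : ℝ)) :
    ((smulCoordLo XL XH c : ℤ) : ℝ) ≤ S * (x * (c : ℝ)) := by
  have h := cornerLo_le (glo := c) (ghi := c) h1 h2 le_rfl le_rfl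
  refine le_trans ?_ h
  unfold smulCoordLo cornerLo; push_cast
  simp only [min_self, le_refl]

/-- `S·(x·c) ≤ smulCoordHi`. [folklore] -/
theorem le_smulCoordHi {S XL XH : ℤ} {c : ℚ} {x : ℝ} (h1 : (XL : ℝ) ≤ S * x) (h2 : S * x ≤ (XH : ℝ)) :
    S * (x * (c : ℝ)) ≤ ((smulCoordHi XL XH c : ℤ) : ℝ) := by
  have h := le_cornerHi (glo := c) (ghi := c) h1 h2 le_rfl le_rfl
  refine h.trans ?_
  unfold smulCoordHi cornerHi; push_cast
  simp only [max_self, le_refl]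

/-- ★ LOWER reading of coordinate `i` of (252) `linLab G z y = ψ(g z z)·y + (2·g(z,y)·ψ′(g z z))·z`: the `ψ` window `[lo, hi]` of
`g z z`, the exact interval `[glo, ghi]` of `g(z, y)`, the exact rationals `y i`, `z i`. [folklore] -/
def linLabLoZ (S : ℤ) (lo hi glo ghi yi zi : ℚ) : ℤ :=
  smulCoordLo (psiLoZ S lo hi) (psiHiZ S lo hi) yi
    + cornerLo (psi1LoZ S lo hi) (psi1HiZ S lo hi) (min (2 * glo * zi) (2 * ghi * zi)) (max (2 * glo * zi) (2 * ghi * zi))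

/-- ★ UPPER reading of coordinate `i` of `linLab G z y`. [folklore] -/
def linLabHiZ (S : ℤ) (lo hi glo ghi yi zi : ℚ) : ℤ :=
  smulCoordHi (psiLoZ S lo hi) (psiHiZ S lo hi) yi
    + cornerHi (psi1LoZ S lo hi) (psi1HiZ S lo hi) (min (2 * glo * zi) (2 * ghi * zi)) (max (2 * glo * zi) (2 * ghi * zi))

section LinLab

variable {S : ℤ} {G : Matrix (Fin 3) (Fin 3) ℝ} {z y : Fin 3 → ℝ} {lo hi glo ghi : ℚ} {yq zq : Fin 3 → ℚ} {i : Fin 3}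

/-- the exact interval of `2·g(z,y)·z i` from that of `g(z,y)` and the rational `z i` (either sign). -/
theorem two_mul_mem (hg1 : (glo : ℝ) ≤ gram G z y) (hg2 : gram G z y ≤ (ghi : ℝ)) (hz : z i = (zq i : ℝ)) :
    ((min (2 * glo * zq i) (2 * ghi * zq i) : ℚ) : ℝ) ≤ 2 * gram G z y * z i
      ∧ 2 * gram G z y * z i ≤ ((max (2 * glo * zq i) (2 * ghi * zq i) : ℚ) : ℝ) := by
  rw [hz]; push_cast
  rcases le_total 0 ((zq i : ℚ) : ℝ) with hc | hc
  · constructor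
    · exact (min_le_left _ _).trans (by nlinarith)
    · exact le_trans (by nlinarith) (le_max_right _ _)
  · constructor
    · exact (min_le_right _ _).trans (by nlinarith)
    · exact le_trans (by nlinarith) (le_max_left _ _)

/-- ★ `linLabLoZ ≤ S·(linLab G z y) i`. [folklore] -/
theorem linLabLoZ_le (hS : 0 < S) (h0 : 0 < lo) (h1 : (lo : ℝ) ≤ gram G z z) (h2 : gram G z z ≤ (hi : ℝ))
    (hg1 : (glo : ℝ) ≤ gram G z y) (hg2 : gram G z y ≤ (ghi : ℝ)) (hy : y i = (yq i : ℝ)) (hz : z i = (zq i : ℝ)) :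
    ((linLabLoZ S lo hi glo ghi (yq i) (zq i) : ℤ) : ℝ) ≤ S * linLab G z y i := by
  have A := smulCoordLo_le (c := yq i) (psiLoZ_le hS h0 h1 h2) (le_psiHiZ hS h0 h1 h2)
  obtain ⟨m1, m2⟩ := two_mul_mem hg1 hg2 hz
  have B := cornerLo_le (psi1LoZ_le hS h0 h1 h2) (le_psi1HiZ hS h0 h1 h2) m1 m2
  unfold linLabLoZ
  have e : S * linLab G z y i = S * (psiT (gram G z z) * (yq i : ℝ)) + S * (psiT1 (gram G z z) * (2 * gram G z y * z i)) := by
    simp only [linLab, Pi.add_apply, Pi.smul_apply, smul_eq_mul, hy]; ring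
  rw [e]; push_cast; exact add_le_add A B

/-- ★ `S·(linLab G z y) i ≤ linLabHiZ`. [folklore] -/
theorem le_linLabHiZ (hS : 0 < S) (h0 : 0 < lo) (h1 : (lo : ℝ) ≤ gram G z z) (h2 : gram G z z ≤ (hi : ℝ))
    (hg1 : (glo : ℝ) ≤ gram G z y) (hg2 : gram G z y ≤ (ghi : ℝ)) (hy : y i = (yq i : ℝ)) (hz : z i = (zq i : ℝ)) :
    S * linLab G z y i ≤ ((linLabHiZ S lo hi glo ghi (yq i) (zq i) : ℤ) : ℝ) := by
  have A := le_smulCoordHi (c := yq i) (psiLoZ_le hS h0 h1 h2) (le_psiHiZ hS h0 h1 h2)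
  obtain ⟨m1, m2⟩ := two_mul_mem hg1 hg2 hz
  have B := le_cornerHi (psi1LoZ_le hS h0 h1 h2) (le_psi1HiZ hS h0 h1 h2) m1 m2
  unfold linLabHiZ
  have e : S * linLab G z y i = S * (psiT (gram G z z) * (yq i : ℝ)) + S * (psiT1 (gram G z z) * (2 * gram G z y * z i)) := by
    simp only [linLab, Pi.add_apply, Pi.smul_apply, smul_eq_mul, hy]; ring
  rw [e]; push_cast; exact add_le_add A B

/-- ★ the leading term of `nashVecLab`: readings of `(ψ(g(a,a))·a) i` from the `ψ` window and the rational `a i`. [folklore] -/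
theorem smul_coord_mem (hS : 0 < S) (h0 : 0 < lo) (h1 : (lo : ℝ) ≤ gram G z z) (h2 : gram G z z ≤ (hi : ℝ))
    (hz : z i = (zq i : ℝ)) :
    ((smulCoordLo (psiLoZ S lo hi) (psiHiZ S lo hi) (zq i) : ℤ) : ℝ) ≤ S * (psiT (gram G z z) • z) i
      ∧ S * (psiT (gram G z z) • z) i ≤ ((smulCoordHi (psiLoZ S lo hi) (psiHiZ S lo hi) (zq i) : ℤ) : ℝ) := by
  have A := smulCoordLo_le (c := zq i) (psiLoZ_le hS h0 h1 h2) (le_psiHiZ hS h0 h1 h2)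
  have B := le_smulCoordHi (c := zq i) (psiLoZ_le hS h0 h1 h2) (le_psiHiZ hS h0 h1 h2)
  simp only [Pi.smul_apply, smul_eq_mul, hz]
  exact ⟨A, B⟩

end LinLab

end Summit.AtomisticToContinuum.Crystallization.Theorems.FrustratedLawDichotomyCellArithGram
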